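import Literature.NumberTheory.ComplexMultiplication.TateHypEllPowerTowerOfCMElliptic
import Literature.NumberTheory.ComplexMultiplication.CMLatticeRankPigeonhole
import HarnessLib

/-!
# Tate's hypothesis along `ℓ`-power towers for an abelian variety with a matrix CM action

Theorems only (topic `NumberTheory/ComplexMultiplication`; no definition, no named fact).
Rank-`r` sequel of `TateHypEllPowerTowerOfCMElliptic` (rank one).

Let `P` be an abelian variety over a field `k` carrying a ring homomorphism
`ιP : M_r(𝓞_K) → End P` (the case in point: `P = A₀ʳ` for `(A₀, ι₀ : 𝓞_K → End A₀)` a CM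
abelian variety, `ιP` the matrix endomorphisms), such that `T_ℓ P` is FREE OF RANK `r` OVER
`ℤ_ℓ ⊗ 𝓞_K`: there are `t_i ∈ T_ℓ P`, an integral basis `(b_k)` of `𝓞_K` and a `ℤ_ℓ`-basis
`B_{i,k} = T_ℓ(ιP(b_k · 1)) t_i`, with `T_ℓ(ιP e) t_i = Σ_j T_ℓ(ιP(e_{ji} · 1)) t_j`.
**Tate's finiteness hypothesis along `ℓ`-power towers** `AbelianVariety.tateHypEllPowerTower P ℓ`
(Tate 1966 §2; the residual citation of row VI-1 of the cell's floor, re-keyed on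
[Fal83 Thm 1 + Thm 2]) **holds for `P` as soon as the Galois-stable lattices of `T_ℓ P` are
stable under the scalar order `ℓᴺ 𝓞_K`** (`tateHypEllPowerTower_of_matrixAction_of_stableIndex`)
— in particular as soon as ONE element of `Γ_k` acts on `T_ℓ P` as the scalar `T_ℓ(ιP(π · 1))`
with `ℚ(π) = K` (`tateHypEllPowerTower_of_matrixAction_of_tateRep_eq`; `disc ℤ[π] · 𝓞_K ⊆ ℤ[π]`,
`exists_stableIndex_of_tateRep_eq_tateModuleMap`).  Proof: the tower's lattices
`X n = T_ℓ(f n)(T_ℓ B n)` are `Γ_k`-stable and contain `ℓⁿ T_ℓ P`; the rank-`r` class / shape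
pigeonhole (`exists_infinite_forall_exists_matrix_pow_smul_map_eq`: Steinitz splitting over the
Dedekind domain `𝓞_K`, `Cl(K)` finite, shapes modulo `ℓ^{N+j₀}`) relates two of them on an
infinite index set by a global `ℓ`-unit `e ∈ M_r(𝓞_K)`, `ℓᶜ T_ℓ(ιP e) X m = ℓᵃ X n`,
`e e' = e' e = ℓᵈ`; and an endomorphism realising the lattice relation gives `B m ≅ B n`
(`AbelianVariety.nonempty_iso_of_ellPowerTower_of_pow_smul_map_range_eq`, Tate 1966 §2 p. 137 /
Milne AV IV §2).  No polarisation, no height, no [Fal83] input.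

## References

* [Tate1966Endomorphisms] J. Tate, Invent. Math. 2 (1966), §2, pp. 136–137.
* [Shimura1998] G. Shimura, *Abelian Varieties with Complex Multiplication and Modular Functions*
  (1998), §7.4 Props. 15, 17.
* [Reiner2003MaximalOrders] I. Reiner, *Maximal Orders*, §4 (Steinitz), §26 (Jordan–Zassenhaus).
-/

noncomputable section

open CategoryTheory Polynomial
open scoped NumberField Pointwise IntermediateField

namespace Literature.NumberTheory.ComplexMultiplication

open Literature.AlgebraicGeometry.Motives Literature.AlgebraicGeometry.Motives.AbelianVariety

/-- **Tate's hypothesis along `ℓ`-power towers for an abelian variety with a matrix CM action of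
rank `r` whose Galois-stable lattices are stable under a scalar order of bounded index** (Tate
1966 §2 for the lattices; Steinitz / Jordan–Zassenhaus over `𝓞_K` for the classes): if
`ιP : M_r(𝓞_K) → End P`, `T_ℓ P` has the `ℤ_ℓ`-basis `B_{i,k} = T_ℓ(ιP(b_k · 1)) t_i` with
`T_ℓ(ιP e) t_i = Σ_j T_ℓ(ιP(e_{ji} · 1)) t_j`, and for some `N`, `ℓᴺ T_ℓ(ιP(a · 1)) X ⊆ X` for every
`Γ_k`-stable `ℤ_ℓ`-submodule `X ⊆ T_ℓ P` and every `a ∈ 𝓞_K`, then along every `ℓ`-power tower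
onto `P` infinitely many members are mutually isomorphic over `k`.
[cite: Tate1966Endomorphisms, §2 pp. 136–137] [cite: Reiner2003MaximalOrders, §26 (Jordan–Zassenhaus theorem)] -/
theorem tateHypEllPowerTower_of_matrixAction_of_stableIndex
    {k : Type} [Field k] {K : Type*} [Field K] [NumberField K]
    (P : AbelianVariety k) {r : ℕ} (ιP : Matrix (Fin r) (Fin r) (𝓞 K) →+* End P)
    (ℓ : ℕ) [Fact ℓ.Prime] (t : Fin r → P.tateModule ℓ) {κ : Type*} [Fintype κ]
    (b : Module.Basis κ ℤ (𝓞 K)) (Bas : Module.Basis (Fin r × κ) ℤ_[ℓ] (P.tateModule ℓ))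
    (hBas : ∀ i k', Bas (i, k') = tateModuleMap ℓ (ιP (b k' • 1) : P ⟶ P) (t i))
    (hMt : ∀ (e : Matrix (Fin r) (Fin r) (𝓞 K)) (i : Fin r),
      tateModuleMap ℓ (ιP e : P ⟶ P) (t i) = ∑ j, tateModuleMap ℓ (ιP (e j i • 1) : P ⟶ P) (t j))
    (N : ℕ)
    (hgal : ∀ X : Submodule ℤ_[ℓ] (P.tateModule ℓ),
      (∀ (σ : Field.absoluteGaloisGroup k) (x : P.tateModule ℓ), x ∈ X → P.tateRep ℓ σ x ∈ X) →
      ∀ (a : 𝓞 K) (x : P.tateModule ℓ), x ∈ X →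
        (ℓ : ℤ_[ℓ]) ^ N • tateModuleMap ℓ (ιP (a • 1) : P ⟶ P) x ∈ X) :
    P.tateHypEllPowerTower ℓ := by
  intro _ B f h hf hh hhf hfh
  classical
  -- the actions `ιM = T_ℓ ∘ ιP` and `ι = ιM (· • 1)` as ring homomorphisms
  let ιM : Matrix (Fin r) (Fin r) (𝓞 K) →+* Module.End ℤ_[ℓ] (P.tateModule ℓ) :=
    { toFun := fun e => tateModuleMap ℓ (ιP e : P ⟶ P)
      map_one' := by simp only [map_one]; exact tateModuleMap_id ℓ P
      map_mul' := fun e e' => by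
        simp only [map_mul]
        change tateModuleMap ℓ ((ιP e' : P ⟶ P) ≫ (ιP e : P ⟶ P)) = _
        rw [tateModuleMap_comp]; rfl
      map_zero' := by simp only [map_zero]; exact tateModuleMap_zero ℓ
      map_add' := fun e e' => by simp only [map_add]; exact tateModuleMap_add ℓ _ _ }
  have hιM : ∀ e, ιM e = tateModuleMap ℓ (ιP e : P ⟶ P) := fun e => rfl
  let sc : 𝓞 K →+* Matrix (Fin r) (Fin r) (𝓞 K) :=
    { toFun := fun a => a • (1 : Matrix (Fin r) (Fin r) (𝓞 K))
      map_one' := one_smul _ _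
      map_mul' := fun a a' => by rw [Matrix.smul_mul, Matrix.one_mul, smul_smul]
      map_zero' := zero_smul _ _
      map_add' := fun a a' => add_smul _ _ _ }
  let ι : 𝓞 K →+* Module.End ℤ_[ℓ] (P.tateModule ℓ) := ιM.comp sc
  have hι : ∀ a, ι a = tateModuleMap ℓ (ιP (a • 1) : P ⟶ P) := fun a => rfl
  have hBas' : ∀ i k', Bas (i, k') = ι (b k') (t i) := fun i k' => by rw [hι]; exact hBas i k'
  have hMt' : ∀ (e : Matrix (Fin r) (Fin r) (𝓞 K)) (i : Fin r), ιM e (t i) = ∑ j, ι (e j i) (t j) :=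
    fun e i => by simp only [hιM, hι]; exact hMt e i
  have hMs : ∀ a : 𝓞 K, ιM (a • 1) = ι a := fun a => rfl
  -- the lattices of the tower
  set X : ℕ → Submodule ℤ_[ℓ] (P.tateModule ℓ) := fun n => LinearMap.range (tateModuleMap ℓ (f n))
    with hX
  have htop : ∀ i, ∃ j : ℕ, (ℓ : ℤ_[ℓ]) ^ j • (⊤ : Submodule ℤ_[ℓ] (P.tateModule ℓ)) ≤ X i :=
    fun i => ⟨i, by
      rw [hX]
      simp only
      rw [← range_tateModuleMap_pow_smul_id ℓ P i, ← hhf i, tateModuleMap_comp]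
      exact LinearMap.range_comp_le_range _ _⟩
  have hst : ∀ (i : ℕ) (a : 𝓞 K) (x : P.tateModule ℓ), x ∈ X i →
      (ℓ : ℤ_[ℓ]) ^ N • ι a x ∈ X i := fun i a x hx =>
    hgal (X i) (fun σ y hy => by
      obtain ⟨z, rfl⟩ := hy
      exact ⟨(B i).tateRep ℓ σ z, tateModuleMap_smul (f i) σ z⟩) a x hx
  -- the class / shape pigeonhole in rank `r`
  obtain ⟨S, hSinf, hS⟩ := exists_infinite_forall_exists_matrix_pow_smul_map_eq ι t b Bas hBas'
    ιM hMt' hMs N X htop hst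
  refine ⟨S, hSinf, fun m hm n hn => ?_⟩
  obtain ⟨e, e', a, c, d, hee', he'e, hrel⟩ := hS m hm n hn
  -- `ιP e` is an isogeny, invertible up to `ℓᵈ`
  have hcomp : ∀ x y : Matrix (Fin r) (Fin r) (𝓞 K),
      y * x = ((ℓ : 𝓞 K) ^ d) • (1 : Matrix (Fin r) (Fin r) (𝓞 K)) →
      (ιP x : P ⟶ P) ≫ (ιP y : P ⟶ P) = (ℓ ^ d) • 𝟙 P := fun x y hxy => by
    change ιP y * ιP x = _
    rw [← map_mul, hxy, ← Nat.cast_pow, Nat.cast_smul_eq_nsmul, nsmul_one, map_natCast,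
      ← nsmul_one]
    rfl
  have he : (ιP e : P ⟶ P) ≫ (ιP e' : P ⟶ P) = (ℓ ^ d) • 𝟙 P := hcomp e e' he'e
  have he' : (ιP e' : P ⟶ P) ≫ (ιP e : P ⟶ P) = (ℓ ^ d) • 𝟙 P := hcomp e' e hee'
  have hcast : ((ℓ ^ d : ℕ) : k) ≠ 0 :=
    Nat.cast_ne_zero.mpr (pow_ne_zero d (Fact.out : ℓ.Prime).ne_zero)
  have hℓd : IsIsogeny ((ℓ ^ d) • 𝟙 P) := isIsogeny_nsmul_id_of_cast_ne_zero P (ℓ ^ d) hcast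
  have heI : IsIsogeny (ιP e : P ⟶ P) :=
    isIsogeny_of_isIsogeny_comp_of_isIsogeny_comp (he ▸ hℓd) (he' ▸ hℓd)
  exact nonempty_iso_of_ellPowerTower_of_pow_smul_map_range_eq ℓ P B f h hf hh hhf hfh
    (ιP e : P ⟶ P) (ιP e' : P ⟶ P) a d c heI he hrel

/-- **Tate's hypothesis along `ℓ`-power towers for an abelian variety with a matrix CM action of
rank `r` and ONE scalar Frobenius generating `K`**: under the basis / matrix-action hypotheses of
`tateHypEllPowerTower_of_matrixAction_of_stableIndex`, if some `σ₀ ∈ Γ_k` acts on `T_ℓ P` as the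
scalar `T_ℓ(ιP(π · 1))` with `ℚ(π) = K`, then `AbelianVariety.tateHypEllPowerTower P ℓ` holds
(the index bound `disc ℤ[π]` from `exists_stableIndex_of_tateRep_eq_tateModuleMap`).  For
`P = A₀ʳ` with `A₀` CM elliptic such a `σ₀` is a Frobenius at a degree-one place (Shimura–Taniyama).
[cite: Tate1966Endomorphisms, §2 pp. 136–137] [cite: Shimura1998, §7.4 Propositions 15 and 17] -/
theorem tateHypEllPowerTower_of_matrixAction_of_tateRep_eq
    {k : Type} [Field k] {K : Type*} [Field K] [NumberField K]
    (P : AbelianVariety k) {r : ℕ} (ιP : Matrix (Fin r) (Fin r) (𝓞 K) →+* End P)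
    (ℓ : ℕ) [Fact ℓ.Prime] (t : Fin r → P.tateModule ℓ) {κ : Type*} [Fintype κ]
    (b : Module.Basis κ ℤ (𝓞 K)) (Bas : Module.Basis (Fin r × κ) ℤ_[ℓ] (P.tateModule ℓ))
    (hBas : ∀ i k', Bas (i, k') = tateModuleMap ℓ (ιP (b k' • 1) : P ⟶ P) (t i))
    (hMt : ∀ (e : Matrix (Fin r) (Fin r) (𝓞 K)) (i : Fin r),
      tateModuleMap ℓ (ιP e : P ⟶ P) (t i) = ∑ j, tateModuleMap ℓ (ιP (e j i • 1) : P ⟶ P) (t j))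
    (σ₀ : Field.absoluteGaloisGroup k) (π : 𝓞 K)
    (hσ₀ : P.tateRep ℓ σ₀ = tateModuleMap ℓ (ιP (π • 1) : P ⟶ P)) (hπ : ℚ⟮(π : K)⟯ = ⊤) :
    P.tateHypEllPowerTower ℓ := by
  let sc : 𝓞 K →+* Matrix (Fin r) (Fin r) (𝓞 K) :=
    { toFun := fun a => a • (1 : Matrix (Fin r) (Fin r) (𝓞 K))
      map_one' := one_smul _ _
      map_mul' := fun a a' => by rw [Matrix.smul_mul, Matrix.one_mul, smul_smul]
      map_zero' := zero_smul _ _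
      map_add' := fun a a' => add_smul _ _ _ }
  have hsc : ∀ a, ιP.comp sc a = ιP (a • 1) := fun a => rfl
  intro hk B f h hf hh hhf hfh
  obtain ⟨N, hN⟩ := exists_stableIndex_of_tateRep_eq_tateModuleMap P (ιP.comp sc) ℓ σ₀ π
    (by rw [hσ₀]; rfl) hπ
  exact tateHypEllPowerTower_of_matrixAction_of_stableIndex P ιP ℓ t b Bas hBas hMt N
    (fun X hX a x hx => by rw [← hsc]; exact hN X hX a x hx) B f h hf hh hhf hfh

end Literature.NumberTheory.ComplexMultiplication

end
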